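import Summits.Ventures.Crystal3D.Theorems.StickyWulffConstantGenericWallFloorRayPushCubic
import HarnessLib

/-!
# The terrace-steered steep family, part 2: forced-ray levels in cubic coordinates, the transient and the invariant
# circle of ray a (crux `GenericWallFloor`, stmt-Ventures-19480, line `WallLedgerG`; the `hdirs` discharge)

HONEST FRAMING. Venture `Summits/Ventures/Crystal3D` (cell `crystal3d-full`), helper `--supports` the crux
`GenericWallFloor` (stmt-Ventures-19480) of `route-Ventures-StickyWulffConstant`, REGISTERED line `WallLedgerG`, open
stub `stub_twoSlabAdhesion`.  Rung credit only; F-C1 not moved; NOT the stub; census-free, standard axioms.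

THE FAMILY.  Base frame `A` (any linear isometry), start slot `u = slotSite 8` (cubic `(0,1,1)/√2`), steering
`z = A ẑ` with `cubicCoords ẑ ∥ (34, 32, 33)` — the terrace normal `(1,1,1)/√3` tilted by `1.3°` (a tie-break: on the nine
zero-cost `Σ3` riser minimizers of RISER-LEDGER-g8 its walks coincide with the menu of record, certified count `4.000`).
By `entries_forced` the directions a stack walker of the family can hold are `A u` and the directions of the two FORCED
RAYS `forcedTop z ⟨A,u,0⟩ n k`, `n` through the cubic normals `(1,1,1)/√3` (ray a, the terrace; `first_normal_cubic`) or
`(−1,1,1)/√3` (ray b, part 3).  In the numerators of `…RayPushCubic` (`X = √2·κ(direction)`, `P = √3·κ(next push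
normal)`, `κ = cubicCoords ∘ A.symm`):
* `forcedTop_zero_cubic` / `forcedTop_succ_cubic` — the levels of a forced ray follow `ray_push_cubic`;
  `triple_selection` — the strict-selection hypotheses from explicit values; `lin_pos_on_ellipse` — a linear function
  with dominant constant is positive on an ellipse (Cauchy–Schwarz);
* `rayA_level0/1/2` — levels `0,1,2` of ray a have `X = (4/3,1/3,1/3), (11/9,−4/9,5/9), (28/27,7/27,25/27)`;
* `rayA_circle_selection/update/bound/levels` — from level `2` on the state lies on the CIRCLE
  `X = (2/3,7/15,16/15) + c·(10/27,−28/135,−19/135) + s·(7/3,22/3,−14/3)` (same shape for `P`), `c² + 405 s² = 1`, on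
  which the middle branch of the rising triple always wins STRICTLY and acts as the rotation
  `(c,s) ↦ (−2c/3 − 15s, −2s/3 + c/27)` (angle `arccos(−2/3)` about the cubic axis `(10,7,16)`), and every direction has
  `X·(1,1,4) ≥ 3` (cosine `≥ 1/2`, in fact `≥ 4/5`, against the cap-centre vertical `(1,1,4)/(3√2)`).
So the reachable direction set is infinite (denominators `3^k`, dense on the circle) but sits inside an explicitly
certified invariant set — the «frame-aware invariant» asked for in ROUTE §86(86b).
WHAT THIS IS NOT: no statement about packings or cells; not the stub; F-C1 not moved.
-/

noncomputable section

namespace Summit.Ventures.Crystal3D.Theorems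

open Summit.Ventures.Crystal3D Finset Matrix
open scoped InnerProductSpace

/-! ### Forced-ray levels in cubic coordinates -/

/-- **Level `k + 1` from level `k`.**  If level `k` of the forced ray over `⟨A, u, 0⟩` (unit menu normal `n` of `A`)
has numerators `(X, P)` (direction, next push normal) and the member `Xj` of the rising triple is strictly `Z`-lowest,
then level `k + 1` has numerators `((4/3)P − Xj, (5/3)P − 2Xj)`. -/
theorem forcedTop_succ_cubic (A : EuclideanSpace ℝ (Fin 3) ≃ₗᵢ[ℝ] EuclideanSpace ℝ (Fin 3))
    {u n z : EuclideanSpace ℝ (Fin 3)} {Zc : Fin 3 → ℝ} {t : ℝ} (hn : ‖n‖ = 1)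
    (hmenu : ∀ w ∈ fccSlots, ⟪A w, n⟫_ℝ = 0 ∨ ⟪A w, n⟫_ℝ = Real.sqrt (2 / 3) ∨ ⟪A w, n⟫_ℝ = -Real.sqrt (2 / 3))
    (hZ : cubicCoords (A.symm z) = t • Zc) (ht : 0 < t) (k : ℕ) {X P Xj : Fin 3 → ℝ}
    (hX : cubicCoords (A.symm ((forcedTop z ⟨A, u, 0⟩ n k).frame (forcedTop z ⟨A, u, 0⟩ n k).dir)) = (Real.sqrt 2)⁻¹ • X)
    (hP : cubicCoords (A.symm (nextNormal (forcedTop z ⟨A, u, 0⟩ n k))) = (Real.sqrt 3)⁻¹ • P)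
    (hj : Xj = X ∨ Xj = (1 / 2 : ℝ) • (-X + P ⨯₃ X + (2 : ℝ) • P) ∨ Xj = (1 / 2 : ℝ) • (-X - P ⨯₃ X + (2 : ℝ) • P))
    (hlt : ∀ Y : Fin 3 → ℝ, (Y = X ∨ Y = (1 / 2 : ℝ) • (-X + P ⨯₃ X + (2 : ℝ) • P) ∨
        Y = (1 / 2 : ℝ) • (-X - P ⨯₃ X + (2 : ℝ) • P)) → Y ≠ Xj → Zc ⬝ᵥ Xj < Zc ⬝ᵥ Y) :
    cubicCoords (A.symm ((forcedTop z ⟨A, u, 0⟩ n (k + 1)).frame (forcedTop z ⟨A, u, 0⟩ n (k + 1)).dir)) =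
        (Real.sqrt 2)⁻¹ • ((4 / 3 : ℝ) • P - Xj) ∧
      cubicCoords (A.symm (nextNormal (forcedTop z ⟨A, u, 0⟩ n (k + 1)))) =
        (Real.sqrt 3)⁻¹ • ((5 / 3 : ℝ) • P - (2 : ℝ) • Xj) := by
  set e := forcedTop z ⟨A, u, 0⟩ n k with he
  obtain ⟨hν, hmenuk, -⟩ := forcedTop_chain_invariant z A u hn hmenu k
  rw [← he] at hν hmenuk
  obtain ⟨hd, hdpos⟩ := forcedTop_dir_mem_pos (z := z) (b := ⟨A, u, 0⟩) (n := n) (k := k) hν hmenuk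
  rw [← he] at hd hdpos
  obtain ⟨hN1, hNmenu⟩ := nextNormal_unit_menu (forcedTop_dir z ⟨A, u, 0⟩ n k) hν hmenuk
  rw [← he] at hN1 hNmenu
  have hNpos : ⟪e.frame e.dir, nextNormal e⟫_ℝ = Real.sqrt (2 / 3) := by
    have hdd : ⟪e.frame e.dir, e.frame e.dir⟫_ℝ = 1 := by
      rw [LinearIsometryEquiv.inner_map_map, real_inner_self_eq_norm_sq, norm_eq_one_of_mem_fccSlots hd, one_pow]
    show ⟪e.frame e.dir, (2 * Real.sqrt (2 / 3)) • e.frame e.dir - e.nrm⟫_ℝ = Real.sqrt (2 / 3)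
    rw [inner_sub_right, real_inner_smul_right, hdd, hdpos]; ring
  have h := ray_push_cubic A e.frame hd hN1 hNmenu hNpos hX hP hZ ht hj hlt
  have hfr : (forcedTop z ⟨A, u, 0⟩ n (k + 1)).frame = twinFrame e.frame (nextNormal e) := rfl
  have hdr : (forcedTop z ⟨A, u, 0⟩ n (k + 1)).dir = bestCapper (twinFrame e.frame (nextNormal e)) (nextNormal e) z := rfl
  have hnr : (forcedTop z ⟨A, u, 0⟩ n (k + 1)).nrm = nextNormal e := rfl
  refine ⟨by rw [hfr, hdr]; exact h.1, ?_⟩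
  rw [nextNormal, hfr, hdr, hnr]
  exact h.2

/-- **Level `0` from the bottom.**  With `X₀ = √2·κ(A u) = √2·cubicCoords u` and `P₀ = √3·κ(n)`, level `0` of the
forced ray through `n` has numerators `((4/3)P₀ − Xj, (5/3)P₀ − 2Xj)` for the strictly `Z`-lowest member `Xj`. -/
theorem forcedTop_zero_cubic (A : EuclideanSpace ℝ (Fin 3) ≃ₗᵢ[ℝ] EuclideanSpace ℝ (Fin 3))
    {u n z : EuclideanSpace ℝ (Fin 3)} {Zc : Fin 3 → ℝ} {t : ℝ} (hu : u ∈ fccSlots) (hn : ‖n‖ = 1)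
    (hmenu : ∀ w ∈ fccSlots, ⟪A w, n⟫_ℝ = 0 ∨ ⟪A w, n⟫_ℝ = Real.sqrt (2 / 3) ∨ ⟪A w, n⟫_ℝ = -Real.sqrt (2 / 3))
    (hpos : ⟪A u, n⟫_ℝ = Real.sqrt (2 / 3))
    (hZ : cubicCoords (A.symm z) = t • Zc) (ht : 0 < t) {X P Xj : Fin 3 → ℝ}
    (hX : cubicCoords u = (Real.sqrt 2)⁻¹ • X) (hP : cubicCoords (A.symm n) = (Real.sqrt 3)⁻¹ • P)
    (hj : Xj = X ∨ Xj = (1 / 2 : ℝ) • (-X + P ⨯₃ X + (2 : ℝ) • P) ∨ Xj = (1 / 2 : ℝ) • (-X - P ⨯₃ X + (2 : ℝ) • P))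
    (hlt : ∀ Y : Fin 3 → ℝ, (Y = X ∨ Y = (1 / 2 : ℝ) • (-X + P ⨯₃ X + (2 : ℝ) • P) ∨
        Y = (1 / 2 : ℝ) • (-X - P ⨯₃ X + (2 : ℝ) • P)) → Y ≠ Xj → Zc ⬝ᵥ Xj < Zc ⬝ᵥ Y) :
    cubicCoords (A.symm ((forcedTop z ⟨A, u, 0⟩ n 0).frame (forcedTop z ⟨A, u, 0⟩ n 0).dir)) =
        (Real.sqrt 2)⁻¹ • ((4 / 3 : ℝ) • P - Xj) ∧
      cubicCoords (A.symm (nextNormal (forcedTop z ⟨A, u, 0⟩ n 0))) =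
        (Real.sqrt 3)⁻¹ • ((5 / 3 : ℝ) • P - (2 : ℝ) • Xj) := by
  have hX' : cubicCoords (A.symm (A u)) = (Real.sqrt 2)⁻¹ • X := by rw [A.symm_apply_apply]; exact hX
  have h := ray_push_cubic A A hu hn hmenu hpos hX' hP hZ ht hj hlt
  exact ⟨h.1, h.2⟩

/-! ### Selection from explicit values -/

/-- The selection hypotheses of `ray_push_cubic` from explicit values of the triple. -/
theorem triple_selection {X P Zc Xj X₂ X₃ : Fin 3 → ℝ}
    (h₂ : (1 / 2 : ℝ) • (-X + P ⨯₃ X + (2 : ℝ) • P) = X₂) (h₃ : (1 / 2 : ℝ) • (-X - P ⨯₃ X + (2 : ℝ) • P) = X₃)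
    (hj : Xj = X ∨ Xj = X₂ ∨ Xj = X₃)
    (hl₁ : Xj ≠ X → Zc ⬝ᵥ Xj < Zc ⬝ᵥ X) (hl₂ : Xj ≠ X₂ → Zc ⬝ᵥ Xj < Zc ⬝ᵥ X₂) (hl₃ : Xj ≠ X₃ → Zc ⬝ᵥ Xj < Zc ⬝ᵥ X₃) :
    (Xj = X ∨ Xj = (1 / 2 : ℝ) • (-X + P ⨯₃ X + (2 : ℝ) • P) ∨ Xj = (1 / 2 : ℝ) • (-X - P ⨯₃ X + (2 : ℝ) • P)) ∧
    (∀ Y : Fin 3 → ℝ, (Y = X ∨ Y = (1 / 2 : ℝ) • (-X + P ⨯₃ X + (2 : ℝ) • P) ∨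
        Y = (1 / 2 : ℝ) • (-X - P ⨯₃ X + (2 : ℝ) • P)) → Y ≠ Xj → Zc ⬝ᵥ Xj < Zc ⬝ᵥ Y) := by
  rw [h₂, h₃]
  refine ⟨hj, ?_⟩
  rintro Y (rfl | rfl | rfl) hne
  · exact hl₁ (Ne.symm hne)
  · exact hl₂ (Ne.symm hne)
  · exact hl₃ (Ne.symm hne)


/-! ### Small tools -/

/-- A linear function is positive on the ellipse `c² + A s² = 1` when its constant beats the amplitude:
`0 < l₀`, `A l₁² + l₂² < A l₀²` ⇒ `0 < l₀ + l₁ c + l₂ s`. -/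
theorem lin_pos_on_ellipse {A l₀ l₁ l₂ c s : ℝ} (hA : 0 < A) (h : c ^ 2 + A * s ^ 2 = 1) (h0 : 0 < l₀)
    (h1 : A * l₁ ^ 2 + l₂ ^ 2 < A * l₀ ^ 2) : 0 < l₀ + l₁ * c + l₂ * s := by
  have key : A * (l₁ * c + l₂ * s) ^ 2 ≤ A * l₁ ^ 2 + l₂ ^ 2 := by
    have e : (A * l₁ ^ 2 + l₂ ^ 2) * (c ^ 2 + A * s ^ 2) - A * (l₁ * c + l₂ * s) ^ 2 = (A * l₁ * s - l₂ * c) ^ 2 := by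
      ring
    rw [h, mul_one] at e
    nlinarith [sq_nonneg (A * l₁ * s - l₂ * c), e]
  have hsq : (l₁ * c + l₂ * s) ^ 2 < l₀ ^ 2 := by
    by_contra hc
    push Not at hc
    have := mul_le_mul_of_nonneg_left hc hA.le
    linarith
  by_contra hneg
  push Not at hneg
  have h2 : l₁ * c + l₂ * s ≤ -l₀ := by linarith
  have h3 : l₀ ^ 2 ≤ (l₁ * c + l₂ * s) ^ 2 := by nlinarith [h2, h0]
  linarith

/-- The start slot `slotSite 8` has cubic numerator `(0, 1, 1)`. -/
theorem cubicCoords_slotSite_eight : cubicCoords (slotSite 8) = (Real.sqrt 2)⁻¹ • (![0, 1, 1] : Fin 3 → ℝ) := by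
  rw [cubicCoords_slotSite]
  ext i
  fin_cases i <;> simp [NearIdentity.slotVec, NearIdentity.slotInt, div_eq_mul_inv]

/-- **The two first push normals.**  A unit menu normal `n` of `A` through which the start slot rises has cubic
numerator `(1,1,1)` (the terrace, ray a) or `(−1,1,1)` (ray b). -/
theorem first_normal_cubic (A : EuclideanSpace ℝ (Fin 3) ≃ₗᵢ[ℝ] EuclideanSpace ℝ (Fin 3)) {n : EuclideanSpace ℝ (Fin 3)}
    (hn : ‖n‖ = 1)
    (hmenu : ∀ w ∈ fccSlots, ⟪A w, n⟫_ℝ = 0 ∨ ⟪A w, n⟫_ℝ = Real.sqrt (2 / 3) ∨ ⟪A w, n⟫_ℝ = -Real.sqrt (2 / 3))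
    (hpos : ⟪A (slotSite 8), n⟫_ℝ = Real.sqrt (2 / 3)) :
    cubicCoords (A.symm n) = (Real.sqrt 3)⁻¹ • (![1, 1, 1] : Fin 3 → ℝ) ∨
      cubicCoords (A.symm n) = (Real.sqrt 3)⁻¹ • (![-1, 1, 1] : Fin 3 → ℝ) := by
  obtain ⟨hs2, hs3, hs2p, hs3p, h23⟩ := sqrt_two_three_facts
  obtain ⟨k, hk, hkc⟩ := menu_cubic_coords_pm_one A hn hmenu
  have hcoord : ∀ j, cubicCoords (A.symm n) j = (k j : ℝ) * (Real.sqrt 3)⁻¹ := by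
    intro j
    have h1 : ⟪A (cubicFrame j), n⟫_ℝ = cubicCoords (A.symm n) j := by
      have h := A.inner_map_map (cubicFrame j) (A.symm n)
      rw [A.apply_symm_apply] at h
      rw [h, ← inner_cubicFrame, real_inner_comm]
    have h2 := hkc j
    rw [h1] at h2
    field_simp
    linarith
  -- positivity of the start slot forces `k 1 = k 2 = 1`
  have hsum : (k 1 : ℝ) + k 2 = 2 := by
    have h := hpos
    rw [inner_eq_cubic_symm A, A.symm_apply_apply, cubicCoords_slotSite_eight, smul_dotProduct] at h
    norm_num [dotProduct, Fin.sum_univ_three, Matrix.cons_val_zero, Matrix.cons_val_one, Matrix.cons_val_two,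
      Matrix.head_cons, Matrix.tail_cons, hcoord, h23] at h
    field_simp at h
    nlinarith [h, hs2, hs3, hs2p, hs3p]
  have hsumZ : k 1 + k 2 = 2 := by exact_mod_cast hsum
  have hk1 : k 1 = 1 := by rcases hk 1 with h | h <;> rcases hk 2 with h' | h' <;> omega
  have hk2 : k 2 = 1 := by rcases hk 1 with h | h <;> rcases hk 2 with h' | h' <;> omega
  rcases hk 0 with h0 | h0
  · left
    ext j
    fin_cases j <;> simp [hcoord, h0, hk1, hk2]
  · right
    ext j
    fin_cases j <;> simp [hcoord, h0, hk1, hk2]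

/-! ### Ray a (through the terrace): transient levels 0–2 and the invariant circle about `(10,7,16)` -/

/-- Ray a, level `0`: direction numerator `('4/3', '1/3', '1/3')`, next push normal `('5/3', '-1/3', '-1/3')`. -/
theorem rayA_level0 (A : EuclideanSpace ℝ (Fin 3) ≃ₗᵢ[ℝ] EuclideanSpace ℝ (Fin 3))
    {n z : EuclideanSpace ℝ (Fin 3)} {t : ℝ} (hn : ‖n‖ = 1)
    (hmenu : ∀ w ∈ fccSlots, ⟪A w, n⟫_ℝ = 0 ∨ ⟪A w, n⟫_ℝ = Real.sqrt (2 / 3) ∨ ⟪A w, n⟫_ℝ = -Real.sqrt (2 / 3))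
    (hpos : ⟪A (slotSite 8), n⟫_ℝ = Real.sqrt (2 / 3))
    (hPn : cubicCoords (A.symm n) = (Real.sqrt 3)⁻¹ • (![(1 : ℝ), 1, 1] : Fin 3 → ℝ))
    (hZ : cubicCoords (A.symm z) = t • (![(34 : ℝ), 32, 33] : Fin 3 → ℝ)) (ht : 0 < t) :
    cubicCoords (A.symm ((forcedTop z ⟨A, slotSite 8, 0⟩ n 0).frame (forcedTop z ⟨A, slotSite 8, 0⟩ n 0).dir)) =
        (Real.sqrt 2)⁻¹ • (![(4 : ℝ)/3, 1/3, 1/3] : Fin 3 → ℝ) ∧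
      cubicCoords (A.symm (nextNormal (forcedTop z ⟨A, slotSite 8, 0⟩ n 0))) =
        (Real.sqrt 3)⁻¹ • (![(5 : ℝ)/3, -1/3, -1/3] : Fin 3 → ℝ) := by
  have hsel := triple_selection (X := (![(0 : ℝ), 1, 1] : Fin 3 → ℝ)) (P := (![(1 : ℝ), 1, 1] : Fin 3 → ℝ))
    (Zc := (![(34 : ℝ), 32, 33] : Fin 3 → ℝ)) (Xj := (![(0 : ℝ), 1, 1] : Fin 3 → ℝ)) (X₂ := (![(1 : ℝ), 0, 1] : Fin 3 → ℝ)) (X₃ := (![(1 : ℝ), 1, 0] : Fin 3 → ℝ))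
    (by ext i; fin_cases i <;> norm_num [cross_apply, Matrix.cons_val_zero, Matrix.cons_val_one, Matrix.cons_val_two, Matrix.head_cons, Matrix.tail_cons])
    (by ext i; fin_cases i <;> norm_num [cross_apply, Matrix.cons_val_zero, Matrix.cons_val_one, Matrix.cons_val_two, Matrix.head_cons, Matrix.tail_cons])
    (Or.inl rfl)
    (fun h => (h rfl).elim)
    (fun _ => by norm_num [dotProduct, Fin.sum_univ_three, Matrix.cons_val_zero, Matrix.cons_val_one,
      Matrix.cons_val_two, Matrix.head_cons, Matrix.tail_cons])
    (fun _ => by norm_num [dotProduct, Fin.sum_univ_three, Matrix.cons_val_zero, Matrix.cons_val_one,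
      Matrix.cons_val_two, Matrix.head_cons, Matrix.tail_cons])
  obtain ⟨h1, h2⟩ := forcedTop_zero_cubic A (slotSite_mem 8) hn hmenu hpos hZ ht cubicCoords_slotSite_eight hPn
    hsel.1 hsel.2
  have e1 : ((4 / 3 : ℝ) • (![(1 : ℝ), 1, 1] : Fin 3 → ℝ) - ![(0 : ℝ), 1, 1]) = ![(4 : ℝ)/3, 1/3, 1/3] := by
    ext i; fin_cases i <;> norm_num [Matrix.cons_val_zero, Matrix.cons_val_one, Matrix.cons_val_two, Matrix.head_cons, Matrix.tail_cons]
  have e2 : ((5 / 3 : ℝ) • (![(1 : ℝ), 1, 1] : Fin 3 → ℝ) - (2 : ℝ) • ![(0 : ℝ), 1, 1]) = ![(5 : ℝ)/3, -1/3, -1/3] := by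
    ext i; fin_cases i <;> norm_num [Matrix.cons_val_zero, Matrix.cons_val_one, Matrix.cons_val_two, Matrix.head_cons, Matrix.tail_cons]
  rw [e1] at h1; rw [e2] at h2
  exact ⟨h1, h2⟩

/-- Ray a, level `1`: direction numerator `('11/9', '-4/9', '5/9')`, next push normal `('7/9', '-5/9', '13/9')`. -/
theorem rayA_level1 (A : EuclideanSpace ℝ (Fin 3) ≃ₗᵢ[ℝ] EuclideanSpace ℝ (Fin 3))
    {n z : EuclideanSpace ℝ (Fin 3)} {t : ℝ} (hn : ‖n‖ = 1)
    (hmenu : ∀ w ∈ fccSlots, ⟪A w, n⟫_ℝ = 0 ∨ ⟪A w, n⟫_ℝ = Real.sqrt (2 / 3) ∨ ⟪A w, n⟫_ℝ = -Real.sqrt (2 / 3))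
    (hpos : ⟪A (slotSite 8), n⟫_ℝ = Real.sqrt (2 / 3))
    (hPn : cubicCoords (A.symm n) = (Real.sqrt 3)⁻¹ • (![(1 : ℝ), 1, 1] : Fin 3 → ℝ))
    (hZ : cubicCoords (A.symm z) = t • (![(34 : ℝ), 32, 33] : Fin 3 → ℝ)) (ht : 0 < t) :
    cubicCoords (A.symm ((forcedTop z ⟨A, slotSite 8, 0⟩ n 1).frame (forcedTop z ⟨A, slotSite 8, 0⟩ n 1).dir)) =
        (Real.sqrt 2)⁻¹ • (![(11 : ℝ)/9, -4/9, 5/9] : Fin 3 → ℝ) ∧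
      cubicCoords (A.symm (nextNormal (forcedTop z ⟨A, slotSite 8, 0⟩ n 1))) =
        (Real.sqrt 3)⁻¹ • (![(7 : ℝ)/9, -5/9, 13/9] : Fin 3 → ℝ) := by
  have hsel := triple_selection (X := (![(4 : ℝ)/3, 1/3, 1/3] : Fin 3 → ℝ)) (P := (![(5 : ℝ)/3, -1/3, -1/3] : Fin 3 → ℝ))
    (Zc := (![(34 : ℝ), 32, 33] : Fin 3 → ℝ)) (Xj := (![(1 : ℝ), 0, -1] : Fin 3 → ℝ)) (X₂ := (![(1 : ℝ), -1, 0] : Fin 3 → ℝ)) (X₃ := (![(1 : ℝ), 0, -1] : Fin 3 → ℝ))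
    (by ext i; fin_cases i <;> norm_num [cross_apply, Matrix.cons_val_zero, Matrix.cons_val_one, Matrix.cons_val_two, Matrix.head_cons, Matrix.tail_cons])
    (by ext i; fin_cases i <;> norm_num [cross_apply, Matrix.cons_val_zero, Matrix.cons_val_one, Matrix.cons_val_two, Matrix.head_cons, Matrix.tail_cons])
    (Or.inr (Or.inr rfl))
    (fun _ => by norm_num [dotProduct, Fin.sum_univ_three, Matrix.cons_val_zero, Matrix.cons_val_one,
      Matrix.cons_val_two, Matrix.head_cons, Matrix.tail_cons])
    (fun _ => by norm_num [dotProduct, Fin.sum_univ_three, Matrix.cons_val_zero, Matrix.cons_val_one,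
      Matrix.cons_val_two, Matrix.head_cons, Matrix.tail_cons])
    (fun h => (h rfl).elim)
  obtain ⟨hX, hP⟩ := rayA_level0 A hn hmenu hpos hPn hZ ht
  obtain ⟨h1, h2⟩ := forcedTop_succ_cubic A hn hmenu hZ ht 0 hX hP hsel.1 hsel.2
  have e1 : ((4 / 3 : ℝ) • (![(5 : ℝ)/3, -1/3, -1/3] : Fin 3 → ℝ) - ![(1 : ℝ), 0, -1]) = ![(11 : ℝ)/9, -4/9, 5/9] := by
    ext i; fin_cases i <;> norm_num [Matrix.cons_val_zero, Matrix.cons_val_one, Matrix.cons_val_two, Matrix.head_cons, Matrix.tail_cons]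
  have e2 : ((5 / 3 : ℝ) • (![(5 : ℝ)/3, -1/3, -1/3] : Fin 3 → ℝ) - (2 : ℝ) • ![(1 : ℝ), 0, -1]) = ![(7 : ℝ)/9, -5/9, 13/9] := by
    ext i; fin_cases i <;> norm_num [Matrix.cons_val_zero, Matrix.cons_val_one, Matrix.cons_val_two, Matrix.head_cons, Matrix.tail_cons]
  rw [e1] at h1; rw [e2] at h2
  exact ⟨h1, h2⟩

/-- Ray a, level `2`: direction numerator `('28/27', '7/27', '25/27')`, next push normal `('35/27', '29/27', '11/27')`. -/
theorem rayA_level2 (A : EuclideanSpace ℝ (Fin 3) ≃ₗᵢ[ℝ] EuclideanSpace ℝ (Fin 3))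
    {n z : EuclideanSpace ℝ (Fin 3)} {t : ℝ} (hn : ‖n‖ = 1)
    (hmenu : ∀ w ∈ fccSlots, ⟪A w, n⟫_ℝ = 0 ∨ ⟪A w, n⟫_ℝ = Real.sqrt (2 / 3) ∨ ⟪A w, n⟫_ℝ = -Real.sqrt (2 / 3))
    (hpos : ⟪A (slotSite 8), n⟫_ℝ = Real.sqrt (2 / 3))
    (hPn : cubicCoords (A.symm n) = (Real.sqrt 3)⁻¹ • (![(1 : ℝ), 1, 1] : Fin 3 → ℝ))
    (hZ : cubicCoords (A.symm z) = t • (![(34 : ℝ), 32, 33] : Fin 3 → ℝ)) (ht : 0 < t) :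
    cubicCoords (A.symm ((forcedTop z ⟨A, slotSite 8, 0⟩ n 2).frame (forcedTop z ⟨A, slotSite 8, 0⟩ n 2).dir)) =
        (Real.sqrt 2)⁻¹ • (![(28 : ℝ)/27, 7/27, 25/27] : Fin 3 → ℝ) ∧
      cubicCoords (A.symm (nextNormal (forcedTop z ⟨A, slotSite 8, 0⟩ n 2))) =
        (Real.sqrt 3)⁻¹ • (![(35 : ℝ)/27, 29/27, 11/27] : Fin 3 → ℝ) := by
  have hsel := triple_selection (X := (![(11 : ℝ)/9, -4/9, 5/9] : Fin 3 → ℝ)) (P := (![(7 : ℝ)/9, -5/9, 13/9] : Fin 3 → ℝ))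
    (Zc := (![(34 : ℝ), 32, 33] : Fin 3 → ℝ)) (Xj := (![(0 : ℝ), -1, 1] : Fin 3 → ℝ)) (X₂ := (![(1 : ℝ)/3, 1/3, 4/3] : Fin 3 → ℝ)) (X₃ := (![(0 : ℝ), -1, 1] : Fin 3 → ℝ))
    (by ext i; fin_cases i <;> norm_num [cross_apply, Matrix.cons_val_zero, Matrix.cons_val_one, Matrix.cons_val_two, Matrix.head_cons, Matrix.tail_cons])
    (by ext i; fin_cases i <;> norm_num [cross_apply, Matrix.cons_val_zero, Matrix.cons_val_one, Matrix.cons_val_two, Matrix.head_cons, Matrix.tail_cons])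
    (Or.inr (Or.inr rfl))
    (fun _ => by norm_num [dotProduct, Fin.sum_univ_three, Matrix.cons_val_zero, Matrix.cons_val_one,
      Matrix.cons_val_two, Matrix.head_cons, Matrix.tail_cons])
    (fun _ => by norm_num [dotProduct, Fin.sum_univ_three, Matrix.cons_val_zero, Matrix.cons_val_one,
      Matrix.cons_val_two, Matrix.head_cons, Matrix.tail_cons])
    (fun h => (h rfl).elim)
  obtain ⟨hX, hP⟩ := rayA_level1 A hn hmenu hpos hPn hZ ht
  obtain ⟨h1, h2⟩ := forcedTop_succ_cubic A hn hmenu hZ ht 1 hX hP hsel.1 hsel.2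
  have e1 : ((4 / 3 : ℝ) • (![(7 : ℝ)/9, -5/9, 13/9] : Fin 3 → ℝ) - ![(0 : ℝ), -1, 1]) = ![(28 : ℝ)/27, 7/27, 25/27] := by
    ext i; fin_cases i <;> norm_num [Matrix.cons_val_zero, Matrix.cons_val_one, Matrix.cons_val_two, Matrix.head_cons, Matrix.tail_cons]
  have e2 : ((5 / 3 : ℝ) • (![(7 : ℝ)/9, -5/9, 13/9] : Fin 3 → ℝ) - (2 : ℝ) • ![(0 : ℝ), -1, 1]) = ![(35 : ℝ)/27, 29/27, 11/27] := by
    ext i; fin_cases i <;> norm_num [Matrix.cons_val_zero, Matrix.cons_val_one, Matrix.cons_val_two, Matrix.head_cons, Matrix.tail_cons]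
  rw [e1] at h1; rw [e2] at h2
  exact ⟨h1, h2⟩

/-- Ray a: on the circle the middle member of the rising triple is strictly `Z`-lowest. -/
theorem rayA_circle_selection (c s : ℝ) (h : c ^ 2 + 405 * s ^ 2 = 1) (X P : Fin 3 → ℝ)
    (hX : X = (![(2 : ℝ)/3, 7/15, 16/15] + c • ![(10 : ℝ)/27, -28/135, -19/135] + s • ![(7 : ℝ)/3, 22/3, -14/3])) (hP : P = (![(2 : ℝ)/3, 7/15, 16/15] + c • ![(17 : ℝ)/27, 82/135, -89/135] + s • ![(-43 : ℝ)/3, 50/3, 5/3])) :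
    ((1 / 2 : ℝ) • (-X + P ⨯₃ X + (2 : ℝ) • P) = X ∨ (1 / 2 : ℝ) • (-X + P ⨯₃ X + (2 : ℝ) • P) = (1 / 2 : ℝ) • (-X + P ⨯₃ X + (2 : ℝ) • P) ∨
      (1 / 2 : ℝ) • (-X + P ⨯₃ X + (2 : ℝ) • P) = (1 / 2 : ℝ) • (-X - P ⨯₃ X + (2 : ℝ) • P)) ∧
    (∀ Y : Fin 3 → ℝ, (Y = X ∨ Y = (1 / 2 : ℝ) • (-X + P ⨯₃ X + (2 : ℝ) • P) ∨
        Y = (1 / 2 : ℝ) • (-X - P ⨯₃ X + (2 : ℝ) • P)) → Y ≠ (1 / 2 : ℝ) • (-X + P ⨯₃ X + (2 : ℝ) • P) →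
      (![(34 : ℝ), 32, 33] : Fin 3 → ℝ) ⬝ᵥ ((1 / 2 : ℝ) • (-X + P ⨯₃ X + (2 : ℝ) • P)) < (![(34 : ℝ), 32, 33] : Fin 3 → ℝ) ⬝ᵥ Y) := by
  have hA : (0 : ℝ) < 405 := by norm_num
  have i0 : 0 < (![(34 : ℝ), 32, 33] : Fin 3 → ℝ) ⬝ᵥ X - (![(34 : ℝ), 32, 33] : Fin 3 → ℝ) ⬝ᵥ ((1 / 2 : ℝ) • (-X + P ⨯₃ X + (2 : ℝ) • P)) := by
    have e : (![(34 : ℝ), 32, 33] : Fin 3 → ℝ) ⬝ᵥ X - (![(34 : ℝ), 32, 33] : Fin 3 → ℝ) ⬝ᵥ ((1 / 2 : ℝ) • (-X + P ⨯₃ X + (2 : ℝ) • P)) =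
        (728/15 : ℝ) + (-859/45 : ℝ) * c + (-101 : ℝ) * s + (182/15 : ℝ) * (c ^ 2 + 405 * s ^ 2 - 1) := by
      subst hX; subst hP
      simp [dotProduct, Fin.sum_univ_three, cross_apply, Matrix.cons_val_zero, Matrix.cons_val_one, Matrix.cons_val_two,
        Matrix.head_cons, Matrix.tail_cons]
      ring
    rw [e, h, sub_self, mul_zero, add_zero]
    exact lin_pos_on_ellipse hA h (by norm_num) (by norm_num)
  have i1 : 0 < (![(34 : ℝ), 32, 33] : Fin 3 → ℝ) ⬝ᵥ ((1 / 2 : ℝ) • (-X - P ⨯₃ X + (2 : ℝ) • P)) - (![(34 : ℝ), 32, 33] : Fin 3 → ℝ) ⬝ᵥ ((1 / 2 : ℝ) • (-X + P ⨯₃ X + (2 : ℝ) • P)) := by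
    have e : (![(34 : ℝ), 32, 33] : Fin 3 → ℝ) ⬝ᵥ ((1 / 2 : ℝ) • (-X - P ⨯₃ X + (2 : ℝ) • P)) - (![(34 : ℝ), 32, 33] : Fin 3 → ℝ) ⬝ᵥ ((1 / 2 : ℝ) • (-X + P ⨯₃ X + (2 : ℝ) • P)) =
        (364/15 : ℝ) + (-59/15 : ℝ) * c + (-480 : ℝ) * s + (364/15 : ℝ) * (c ^ 2 + 405 * s ^ 2 - 1) := by
      subst hX; subst hP
      simp [dotProduct, Fin.sum_univ_three, cross_apply, Matrix.cons_val_zero, Matrix.cons_val_one, Matrix.cons_val_two,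
        Matrix.head_cons, Matrix.tail_cons]
      ring
    rw [e, h, sub_self, mul_zero, add_zero]
    exact lin_pos_on_ellipse hA h (by norm_num) (by norm_num)
  refine ⟨Or.inr (Or.inl rfl), ?_⟩
  rintro Y (rfl | rfl | rfl) hne
  · linarith [i0]
  · exact (hne rfl).elim
  · linarith [i1]

/-- Ray a: one push on the circle is the rotation `(c,s) ↦ (c',s')` of the parameters. -/
theorem rayA_circle_update (c s : ℝ) (h : c ^ 2 + 405 * s ^ 2 = 1) (X P : Fin 3 → ℝ)
    (hX : X = (![(2 : ℝ)/3, 7/15, 16/15] + c • ![(10 : ℝ)/27, -28/135, -19/135] + s • ![(7 : ℝ)/3, 22/3, -14/3])) (hP : P = (![(2 : ℝ)/3, 7/15, 16/15] + c • ![(17 : ℝ)/27, 82/135, -89/135] + s • ![(-43 : ℝ)/3, 50/3, 5/3])) :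
    (4 / 3 : ℝ) • P - (1 / 2 : ℝ) • (-X + P ⨯₃ X + (2 : ℝ) • P) = (![(2 : ℝ)/3, 7/15, 16/15] + (-(2 : ℝ) / 3 * c - (1 : ℝ) * 15 * s) • ![(10 : ℝ)/27, -28/135, -19/135] + (-(2 : ℝ) / 3 * s + (1 : ℝ) * (1/27 : ℝ) * c) • ![(7 : ℝ)/3, 22/3, -14/3]) ∧
    (5 / 3 : ℝ) • P - (2 : ℝ) • ((1 / 2 : ℝ) • (-X + P ⨯₃ X + (2 : ℝ) • P)) = (![(2 : ℝ)/3, 7/15, 16/15] + (-(2 : ℝ) / 3 * c - (1 : ℝ) * 15 * s) • ![(17 : ℝ)/27, 82/135, -89/135] + (-(2 : ℝ) / 3 * s + (1 : ℝ) * (1/27 : ℝ) * c) • ![(-43 : ℝ)/3, 50/3, 5/3]) ∧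
    (-(2 : ℝ) / 3 * c - (1 : ℝ) * 15 * s) ^ 2 + 405 * (-(2 : ℝ) / 3 * s + (1 : ℝ) * (1/27 : ℝ) * c) ^ 2 = 1 := by
  subst hX; subst hP
  refine ⟨?_, ?_, by linear_combination h⟩
  · ext i; fin_cases i <;> simp [cross_apply]
    · linear_combination (1/9 : ℝ) * h
    · linear_combination (7/90 : ℝ) * h
    · linear_combination (8/45 : ℝ) * h
  · ext i; fin_cases i <;> simp [cross_apply]
    · linear_combination (2/9 : ℝ) * h
    · linear_combination (7/45 : ℝ) * h
    · linear_combination (16/45 : ℝ) * h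

/-- Ray a: on the circle every direction numerator has `X·(1,1,4) ≥ 3` (cosine `≥ 1/2` against the cap-centre vertical; in fact `≥ 0.8`). -/
theorem rayA_circle_bound (c s : ℝ) (h : c ^ 2 + 405 * s ^ 2 = 1) :
    (3 : ℝ) ≤ (![(2 : ℝ)/3, 7/15, 16/15] + c • ![(10 : ℝ)/27, -28/135, -19/135] + s • ![(7 : ℝ)/3, 22/3, -14/3]) ⬝ᵥ (![(1 : ℝ), 1, 4] : Fin 3 → ℝ) := by
  have e : (![(2 : ℝ)/3, 7/15, 16/15] + c • ![(10 : ℝ)/27, -28/135, -19/135] + s • ![(7 : ℝ)/3, 22/3, -14/3]) ⬝ᵥ (![(1 : ℝ), 1, 4] : Fin 3 → ℝ) = (27/5 : ℝ) + (-2/5 : ℝ) * c + (-9 : ℝ) * s := by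
    simp [dotProduct, Fin.sum_univ_three, Matrix.cons_val_zero, Matrix.cons_val_one, Matrix.cons_val_two, Matrix.head_cons,
      Matrix.tail_cons]; ring
  rw [e]
  have hA : (0 : ℝ) < 405 := by norm_num
  have := lin_pos_on_ellipse (l₀ := (27/5 : ℝ) - 3) (l₁ := (-2/5 : ℝ)) (l₂ := (-9 : ℝ)) hA h (by norm_num) (by norm_num)
  linarith

/-- Ray a: from level `2` on, the forced ray lies on the invariant circle. -/
theorem rayA_circle_levels (A : EuclideanSpace ℝ (Fin 3) ≃ₗᵢ[ℝ] EuclideanSpace ℝ (Fin 3))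
    {n z : EuclideanSpace ℝ (Fin 3)} {t : ℝ} (hn : ‖n‖ = 1)
    (hmenu : ∀ w ∈ fccSlots, ⟪A w, n⟫_ℝ = 0 ∨ ⟪A w, n⟫_ℝ = Real.sqrt (2 / 3) ∨ ⟪A w, n⟫_ℝ = -Real.sqrt (2 / 3))
    (hpos : ⟪A (slotSite 8), n⟫_ℝ = Real.sqrt (2 / 3))
    (hPn : cubicCoords (A.symm n) = (Real.sqrt 3)⁻¹ • (![(1 : ℝ), 1, 1] : Fin 3 → ℝ))
    (hZ : cubicCoords (A.symm z) = t • (![(34 : ℝ), 32, 33] : Fin 3 → ℝ)) (ht : 0 < t) (m : ℕ) :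
    ∃ c s : ℝ, c ^ 2 + 405 * s ^ 2 = 1 ∧
      cubicCoords (A.symm ((forcedTop z ⟨A, slotSite 8, 0⟩ n (2 + m)).frame (forcedTop z ⟨A, slotSite 8, 0⟩ n (2 + m)).dir)) =
        (Real.sqrt 2)⁻¹ • (![(2 : ℝ)/3, 7/15, 16/15] + c • ![(10 : ℝ)/27, -28/135, -19/135] + s • ![(7 : ℝ)/3, 22/3, -14/3]) ∧
      cubicCoords (A.symm (nextNormal (forcedTop z ⟨A, slotSite 8, 0⟩ n (2 + m)))) =
        (Real.sqrt 3)⁻¹ • (![(2 : ℝ)/3, 7/15, 16/15] + c • ![(17 : ℝ)/27, 82/135, -89/135] + s • ![(-43 : ℝ)/3, 50/3, 5/3]) := by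
  induction m with
  | zero =>
    obtain ⟨h1, h2⟩ := rayA_level2 A hn hmenu hpos hPn hZ ht
    refine ⟨1, 0, by norm_num, ?_, ?_⟩
    · rw [Nat.add_zero, h1]; congr 1; ext i; fin_cases i <;> norm_num [Matrix.cons_val_zero, Matrix.cons_val_one, Matrix.cons_val_two, Matrix.head_cons, Matrix.tail_cons]
    · rw [Nat.add_zero, h2]; congr 1; ext i; fin_cases i <;> norm_num [Matrix.cons_val_zero, Matrix.cons_val_one, Matrix.cons_val_two, Matrix.head_cons, Matrix.tail_cons]
  | succ m ih =>
    obtain ⟨c, s, h, hX, hP⟩ := ih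
    obtain ⟨hj, hlt⟩ := rayA_circle_selection c s h _ _ rfl rfl
    obtain ⟨u1, u2, u3⟩ := rayA_circle_update c s h _ _ rfl rfl
    obtain ⟨h1, h2⟩ := forcedTop_succ_cubic A hn hmenu hZ ht (2 + m) hX hP hj hlt
    refine ⟨(-(2 : ℝ) / 3 * c - (1 : ℝ) * 15 * s), (-(2 : ℝ) / 3 * s + (1 : ℝ) * (1/27 : ℝ) * c), u3, ?_, ?_⟩
    · rw [show 2 + (m + 1) = 2 + m + 1 by ring, h1, u1]
    · rw [show 2 + (m + 1) = 2 + m + 1 by ring, h2, u2]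


end Summit.Ventures.Crystal3D.Theorems

end
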